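import Mathlib
import Literature.MathematicalPhysics.QuantumFieldTheory.Balaban1983to89.B5Prop11Plancherel
import Literature.MathematicalPhysics.QuantumFieldTheory.BalabanImbrieJaffe1984to88.BIJ85Sect7Statements

/-!
# `BalabanImbrieJaffe1984to88.BIJ85Eq712Plancherel` — T. Bałaban, J. Imbrie, A. Jaffe, *Renormalization of the Higgs model:
minimizers, propagators and the stability of mean field theory*, Commun. Math. Phys. **97** (1985) 299–329
[BalabanImbrieJaffe1985]: Sect. 7.1 p. 321 — **the momentum representation (7.1.2) of a translation-invariant quadratic form
on the unit torus**, and the Plancherel passage of the proof of Proposition 7.1.2 p. 324 (*"It is sufficient to show that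
there is a constant c > 0 such that c ≤ σ_k(p) (7.1.22)"*) to **Theorem 7.1.1 for the configuration-space operator** — PROVED
for every translation-invariant operator on multi-component fields over a finite torus

statement-level skeleton of published theorems with citation tags; proofs where landed; nothing here is a claim about
the Yang–Mills mass gap

PDF held: `paper:balaban1985-cmp97-bij-higgs-minimizers` (journal page = PDF page + 298).  Text read: PDF pp. 23, 26
(journal 321, 324).

CITATION HEADER (lean-in-tree rule).  Part of the lit-balaban TYPED SKELETON (HOME `run/shared/lean/pub/lit-balaban/`); WHAT IS
REPRODUCED: the display **(7.1.2)** of SKELETON row **C1.Eq7.1.2-7.1.12** (`HOME/lit-balaban-r15/ROWS-C1.md`, owner r15, referee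
ref-5; cell so far *"(7.1.2) Plancherel for the plaquette pairing not typed"*) and the first sentence of the proof of
**Proposition 7.1.2** (rows C1.Prop7.1.2 / C1.Thm7.1.1, whose MODEL INSTANCE `BIJ85Thm711Fibrewise.thm711_fibreModel` (p10 gen 3)
proves Theorem 7.1.1 in the FIBREWISE form (7.1.22) and records *"(7.1.2) … and hence (7.1.1) for the configuration-space
operator σ_k"* as NOT CLAIMED).
THE PRINTED TEXT (p. 321 [PDF 23], verbatim): *"Since we study periodic boundary conditions, σ_k is translation invariant. Thus
it is natural to study σ_k as a multiplication operator σ_k(p) in the Fourier transform representation. … The momenta p have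
d components p_i, and |p_i| ≤ π. We introduce a tensor notation with functions f_{μν} on plaquettes given as antisymmetric
functions on coordinate axes μ, ν which indicates plaquette orientation. They also depend on a lattice position. Then
⟨f^{(k)}, σ_k f^{(k)}⟩ = ∫_{−π}^{π}⋯∫_{−π}^{π} ⟨f̂(p), σ_k(p) f̂(p)⟩ dp, (7.1.2) where the momentum p inner product is defined by
⟨f̂(p), ĝ(p)⟩ = Σ_{μ,ν,λ,κ} … (7.1.3)"*; p. 324 [PDF 26]: *"Proof. It is sufficient to show that there is a constant c > 0 such
that c ≤ σ_k(p) (7.1.22) for all |p_j| ≤ π."*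
TYPED READING.  T₁^{(k)} with periodic boundary conditions = the finite torus `Tor N = Π_μ ℤ/N_μ` of
`Balaban1983to89.B5Prop11Plancherel` (normalised DFT `dft N` of [Balaban1984PropagatorsI] (1.29), unitary); a "function on
plaquettes … antisymmetric … depending on a lattice position" = a multi-component field `f : Tor N × m → ℂ`, `m` any finite
component type; `T : Matrix (Tor N × m) (Tor N × m) ℂ` is TRANSLATION INVARIANT (`IsTranslInv`) iff `T (x+a,i) (y+a,j) =
T (x,i) (y,j)`; its SYMBOL "σ_k(p)" is `symb T p : Matrix m m ℂ`, `Σ_z T((z,i),(0,j)) e^{−ip·z}`; the printed `∫_{−π}^{π} dp` on the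
finite torus is the normalised finite sum over the dual torus ([Balaban1984PropagatorsI] (1.29), absorbed in the unitary `dft`);
the fibre inner product (7.1.3) is `star v ⬝ᵥ w` on `m → ℂ`.
WHAT IS KERNEL-CHECKED (zero `sorry`, standard axioms): `dftC_conj_eq_fibreOp` (`(F⊗1) T (F⊗1)^* = ⊕_p symb T p` — *"a
multiplication operator σ_k(p) in the Fourier transform representation"*); **(7.1.2)** `eq712` (`⟨f,Tf⟩ = Σ_p ⟨f̂(p), σ(p)f̂(p)⟩`)
and `plancherel_dftC`; **(7.1.22) ⇒ (7.1.1)** `form_re_ge_of_fibrewise` (`c‖v‖² ≤ Re⟨v,σ(p)v⟩ ∀ p, v` ⇒ `c‖f‖² ≤ Re⟨f,Tf⟩ ∀ f`)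
and its CONVERSE `fibrewise_of_form_re_ge` (on a finite torus every dual momentum — also those with a vanishing component —
carries modes: the constant of (7.1.1) IS the worst fibre constant); the passage on r15's carrier: `sigmaFormOf`,
`thm711_of_fibrewise : … → Thm711 (sigmaFormOf N m T)`, `thm711_of_realMomenta` (fibres given by a symbol function of the reduced
real momentum `p_ν = 2πn_ν/N_ν ∈ [−π,π]`, `B5Prop11Plancherel.sOf`, under the PRINTED quantifier *"for all |p_j| ≤ π"*, zero
components included), `fibrewise_of_thm711`; for Hermitian `T`: `symb_isHermitian` (the form ⟨f,Tf⟩ is then real — in the tree as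
`QuantumLattice.im_dotProduct_mulVec_self_of_isHermitian` — so the `.re` of §5 discards nothing).
NOT CLAIMED: the identification (7.1.13) of the symbol of σ_k of (4.2.2)/(7.1.12) with τ₁(p) + τ₂(p) of `BIJ85MomentumSymbols71`
(needs the configuration-space G_{k,Ax} of [6I]) — `thm711_of_realMomenta`'s hypothesis `hS` is exactly that input.
Unit `lit-balaban-p27` (gen 4), HOME as above.
-/

namespace Literature.MathematicalPhysics.QuantumFieldTheory.BalabanImbrieJaffe1984to88.BIJ85Eq712Plancherel

open scoped BigOperators Matrix ComplexConjugate
open Finset Complex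
open Literature.MathematicalPhysics.QuantumFieldTheory.Balaban1983to89.B5Prop11Plancherel
open Literature.MathematicalPhysics.QuantumFieldTheory.BalabanImbrieJaffe1984to88.BIJ85Sect7Statements

noncomputable section

/-! ## §1 The Fourier transform of multi-component fields on the unit torus -/

section Torus

variable {d : ℕ} (N : Fin d → ℕ) [hN : ∀ μ, NeZero (N μ)] (m : Type*) [Fintype m] [DecidableEq m]

/-- The Fourier transform `F⊗1` acting on each component of a multi-component (plaquette) field `f : Tor N × m → ℂ`
(*"functions f_{μν} on plaquettes … They also depend on a lattice position"*): `f̂_i(p) = |T|^{−1/2} Σ_x e^{−ip·x} f_i(x)`.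
[cite: BalabanImbrieJaffe1985, (7.1.2) p.321] -/
def dftC : Matrix (Tor N × m) (Tor N × m) ℂ :=
  Matrix.blockDiagonal fun _ : m => dft N

omit [Fintype m] in
/-- entries of `F⊗1` (API of the (7.1.2) Fourier transform). [cite: BalabanImbrieJaffe1985, (7.1.2) p.321] -/
theorem dftC_apply (p : Tor N) (i : m) (x : Tor N) (j : m) :
    dftC N m (p, i) (x, j) = if i = j then dft N p x else 0 := by
  rw [dftC, Matrix.blockDiagonal_apply']

/-- `F⊗1` is unitary — Plancherel on the unit torus (API of (7.1.2)). [cite: BalabanImbrieJaffe1985, (7.1.2) p.321] -/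
theorem dftC_mem_unitaryGroup : dftC N m ∈ Matrix.unitaryGroup (Tor N × m) ℂ := by
  rw [Matrix.mem_unitaryGroup_iff, dftC, Matrix.star_eq_conjTranspose,
    Matrix.blockDiagonal_conjTranspose, ← Matrix.blockDiagonal_mul]
  have h : (fun _ : m => dft N * (dft N)ᴴ) = fun _ => 1 := by
    funext k
    rw [← Matrix.star_eq_conjTranspose, dft_mul_star]
  rw [h]
  exact Matrix.blockDiagonal_one

/-- `(F⊗1)(F⊗1)^* = 1` (API of (7.1.2)). [cite: BalabanImbrieJaffe1985, (7.1.2) p.321] -/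
theorem dftC_mul_star : dftC N m * star (dftC N m) = 1 :=
  Matrix.mem_unitaryGroup_iff.mp (dftC_mem_unitaryGroup N m)

/-- `(F⊗1)^*(F⊗1) = 1` (API of (7.1.2)). [cite: BalabanImbrieJaffe1985, (7.1.2) p.321] -/
theorem star_dftC_mul : star (dftC N m) * dftC N m = 1 :=
  Matrix.mem_unitaryGroup_iff'.mp (dftC_mem_unitaryGroup N m)

/-- kernel: translation covariance of the DFT rows, `F_{p,z+y} = conj(e^{ip·z}) F_{p,y}`. [folklore] -/
private theorem dft_add (p z y : Tor N) : dft N p (z + y) = conj (chi N p z) * dft N p y := by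
  unfold dft
  rw [chi_add_right, map_mul]
  ring

/-- kernel: orthonormality of the DFT rows as a sum, `Σ_y F_{p,y} conj F_{q,y} = δ_{pq}`. [folklore] -/
private theorem sum_dft_mul_conj (p q : Tor N) :
    ∑ y : Tor N, dft N p y * conj (dft N q y) = if p = q then 1 else 0 := by
  have h := congrFun (congrFun (dft_mul_star N) p) q
  rw [Matrix.mul_apply, Matrix.one_apply] at h
  simpa only [Matrix.star_apply, Complex.star_def] using h

/-! ## §2 Translation-invariant operators and their symbols σ(p) -/

/-- *"Since we study periodic boundary conditions, σ_k is translation invariant"* (p. 321): an operator on multi-component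
fields over the torus commuting with all lattice translations. [cite: BalabanImbrieJaffe1985, (7.1.2) p.321] -/
def IsTranslInv (T : Matrix (Tor N × m) (Tor N × m) ℂ) : Prop :=
  ∀ (a x y : Tor N) (i j : m), T (x + a, i) (y + a, j) = T (x, i) (y, j)

variable {N m}

omit hN [Fintype m] [DecidableEq m] in
/-- A translation-invariant operator is a convolution: `T((x,i),(y,j)) = T((x−y,i),(0,j))`.
[cite: BalabanImbrieJaffe1985, (7.1.2) p.321] -/
theorem IsTranslInv.apply_eq {T : Matrix (Tor N × m) (Tor N × m) ℂ} (hT : IsTranslInv N m T) (x y : Tor N)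
    (i j : m) : T (x, i) (y, j) = T (x - y, i) (0, j) := by
  have h := hT (-y) x y i j
  rw [add_neg_cancel, ← sub_eq_add_neg] at h
  exact h.symm

variable (N m)

/-- *"σ_k as a multiplication operator σ_k(p) in the Fourier transform representation"*: the SYMBOL of `T` at the dual
momentum `p` — the `m × m` matrix `σ(p)_{ij} = Σ_z T((z,i),(0,j)) e^{−ip·z}` (Fourier transform of the convolution kernel).
[cite: BalabanImbrieJaffe1985, (7.1.2) p.321] -/
def symb (T : Matrix (Tor N × m) (Tor N × m) ℂ) (p : Tor N) : Matrix m m ℂ :=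
  Matrix.of fun i j => ∑ z : Tor N, T (z, i) (0, j) * conj (chi N p z)

omit [Fintype m] [DecidableEq m] in
/-- entries of the symbol (API of (7.1.2)). [cite: BalabanImbrieJaffe1985, (7.1.2) p.321] -/
theorem symb_apply (T : Matrix (Tor N × m) (Tor N × m) ℂ) (p : Tor N) (i j : m) :
    symb N m T p i j = ∑ z : Tor N, T (z, i) (0, j) * conj (chi N p z) := rfl

/-- The "multiplication operator" with fibres `B(p)`: `(⊕_p B(p)) ((p,i),(q,j)) = δ_{pq} B(p)_{ij}` on `Tor N × m`.
[cite: BalabanImbrieJaffe1985, (7.1.2) p.321] -/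
def fibreOp (B : Tor N → Matrix m m ℂ) : Matrix (Tor N × m) (Tor N × m) ℂ :=
  Matrix.of fun a b => if a.1 = b.1 then B a.1 a.2 b.2 else 0

omit hN [Fintype m] [DecidableEq m] in
/-- entries of the fibre operator (API of (7.1.2)). [cite: BalabanImbrieJaffe1985, (7.1.2) p.321] -/
theorem fibreOp_apply (B : Tor N → Matrix m m ℂ) (p : Tor N) (i : m) (q : Tor N) (j : m) :
    fibreOp N m B (p, i) (q, j) = if p = q then B p i j else 0 := rfl

/-! ## §3 Diagonalization: `(F⊗1) T (F⊗1)^* = ⊕_p σ(p)` -/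

/-- kernel: `((F⊗1) T)((p,i), b) = Σ_x F_{p,x} T((x,i), b)`. [folklore] -/
private theorem dftC_mul_apply (T : Matrix (Tor N × m) (Tor N × m) ℂ) (p : Tor N) (i : m) (b : Tor N × m) :
    (dftC N m * T) (p, i) b = ∑ x : Tor N, dft N p x * T (x, i) b := by
  rw [Matrix.mul_apply, Fintype.sum_prod_type]
  refine Finset.sum_congr rfl fun x _ => ?_
  rw [Finset.sum_eq_single i]
  · rw [dftC_apply, if_pos rfl]
  · intro j _ hj
    rw [dftC_apply, if_neg (Ne.symm hj), zero_mul]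
  · exact fun h => absurd (Finset.mem_univ i) h

/-- kernel: `((F⊗1) T (F⊗1)^*)((p,i),(q,j)) = Σ_x Σ_y F_{p,x} T((x,i),(y,j)) conj F_{q,y}`. [folklore] -/
private theorem dftC_conj_apply_sum (T : Matrix (Tor N × m) (Tor N × m) ℂ) (p q : Tor N) (i j : m) :
    (dftC N m * T * star (dftC N m)) (p, i) (q, j)
      = ∑ x : Tor N, ∑ y : Tor N, dft N p x * T (x, i) (y, j) * conj (dft N q y) := by
  rw [Matrix.mul_apply, Fintype.sum_prod_type]
  have h1 : ∀ y : Tor N, ∑ j' : m, (dftC N m * T) (p, i) (y, j') * (star (dftC N m)) (y, j') (q, j)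
      = (dftC N m * T) (p, i) (y, j) * conj (dft N q y) := by
    intro y
    rw [Finset.sum_eq_single j]
    · rw [Matrix.star_apply, dftC_apply, if_pos rfl, Complex.star_def]
    · intro j' _ hj'
      rw [Matrix.star_apply, dftC_apply, if_neg (Ne.symm hj'), star_zero, mul_zero]
    · exact fun h => absurd (Finset.mem_univ j) h
  simp_rw [h1, dftC_mul_apply, Finset.sum_mul]
  rw [Finset.sum_comm]

/-- **"σ_k is translation invariant. Thus … σ_k [is] a multiplication operator σ_k(p) in the Fourier transform
representation"** (p. 321), entrywise: `((F⊗1) T (F⊗1)^*)((p,i),(q,j)) = δ_{pq} σ(p)_{ij}`.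
[cite: BalabanImbrieJaffe1985, (7.1.2) p.321] -/
theorem dftC_conj_apply {T : Matrix (Tor N × m) (Tor N × m) ℂ} (hT : IsTranslInv N m T) (p q : Tor N) (i j : m) :
    (dftC N m * T * star (dftC N m)) (p, i) (q, j) = if p = q then symb N m T p i j else 0 := by
  rw [dftC_conj_apply_sum, Finset.sum_comm]
  -- substitute x = z + y in the inner sum and use translation invariance
  have h1 : ∀ y : Tor N, ∑ x : Tor N, dft N p x * T (x, i) (y, j) * conj (dft N q y)
      = ∑ z : Tor N, T (z, i) (0, j) * conj (chi N p z) * (dft N p y * conj (dft N q y)) := by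
    intro y
    refine (Fintype.sum_equiv (Equiv.addRight y) _ _ fun z => ?_).symm
    show T (z, i) (0, j) * conj (chi N p z) * (dft N p y * conj (dft N q y))
      = dft N p (z + y) * T (z + y, i) (y, j) * conj (dft N q y)
    rw [hT.apply_eq (z + y) y, add_sub_cancel_right, dft_add]
    ring
  simp_rw [h1]
  rw [Finset.sum_comm]
  simp_rw [← Finset.mul_sum, sum_dft_mul_conj]
  split_ifs with h
  · simp only [mul_one, symb_apply]
  · simp only [mul_zero, Finset.sum_const_zero]

/-- **Diagonalization**: for a translation-invariant `T`, `(F⊗1) T (F⊗1)^* = ⊕_p σ(p)` — σ(p) = `symb T p`.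
[cite: BalabanImbrieJaffe1985, (7.1.2) p.321] -/
theorem dftC_conj_eq_fibreOp {T : Matrix (Tor N × m) (Tor N × m) ℂ} (hT : IsTranslInv N m T) :
    dftC N m * T * star (dftC N m) = fibreOp N m (symb N m T) := by
  ext ⟨p, i⟩ ⟨q, j⟩
  rw [dftC_conj_apply N m hT, fibreOp_apply]

/-- The same, solved for `T`: `T = (F⊗1)^* (⊕_p σ(p)) (F⊗1)`. [cite: BalabanImbrieJaffe1985, (7.1.2) p.321] -/
theorem eq_star_dftC_mul_fibreOp_mul_dftC {T : Matrix (Tor N × m) (Tor N × m) ℂ} (hT : IsTranslInv N m T) :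
    T = star (dftC N m) * fibreOp N m (symb N m T) * dftC N m := by
  rw [← dftC_conj_eq_fibreOp N m hT]
  calc T = (star (dftC N m) * dftC N m) * T * (star (dftC N m) * dftC N m) := by
          rw [star_dftC_mul, Matrix.one_mul, Matrix.mul_one]
    _ = star (dftC N m) * (dftC N m * T * star (dftC N m)) * dftC N m := by simp only [Matrix.mul_assoc]

/-! ## §4 (7.1.2): the quadratic form in momentum space, and Plancherel -/

omit [DecidableEq m] in
/-- kernel: the fibre operator acts fibre by fibre. [folklore] -/
private theorem fibreOp_mulVec_apply (B : Tor N → Matrix m m ℂ) (g : Tor N × m → ℂ) (p : Tor N) (i : m) :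
    (fibreOp N m B *ᵥ g) (p, i) = (B p *ᵥ fun j => g (p, j)) i := by
  simp only [Matrix.mulVec, dotProduct]
  rw [Fintype.sum_prod_type, Finset.sum_eq_single p]
  · simp [fibreOp_apply]
  · intro q _ hq
    simp only [fibreOp_apply, if_neg (Ne.symm hq), zero_mul, Finset.sum_const_zero]
  · exact fun h => absurd (Finset.mem_univ p) h

omit [DecidableEq m] in
/-- kernel: the quadratic form of a fibre operator is the sum of the fibre forms. [folklore] -/
private theorem star_dotProduct_fibreOp_mulVec (B : Tor N → Matrix m m ℂ) (g : Tor N × m → ℂ) :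
    star g ⬝ᵥ (fibreOp N m B *ᵥ g)
      = ∑ p : Tor N, star (fun i => g (p, i)) ⬝ᵥ (B p *ᵥ fun i => g (p, i)) := by
  rw [dotProduct, Fintype.sum_prod_type]
  refine Finset.sum_congr rfl fun p _ => ?_
  rw [dotProduct]
  exact Finset.sum_congr rfl fun i _ => by rw [fibreOp_mulVec_apply]; rfl

/-- **(7.1.2)** p. 321 [PDF 23], verbatim: *"⟨f^{(k)}, σ_k f^{(k)}⟩ = ∫_{−π}^{π}⋯∫_{−π}^{π} ⟨f̂(p), σ_k(p) f̂(p)⟩ dp, (7.1.2)"* — on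
the finite unit torus, for ANY translation-invariant `T` (playing σ_k) and field `f`: `⟨f, Tf⟩ = Σ_p ⟨f̂(p), σ(p) f̂(p)⟩`,
`f̂(p)_i = ((F⊗1) f)(p, i)`, `σ(p) = symb T p`, fibre inner product (7.1.3) = `star v ⬝ᵥ w` (the printed `∫dp` = the normalised
finite sum over the dual torus, [Balaban1984PropagatorsI] (1.29)). [cite: BalabanImbrieJaffe1985, (7.1.2) p.321] -/
theorem eq712 {T : Matrix (Tor N × m) (Tor N × m) ℂ} (hT : IsTranslInv N m T) (f : Tor N × m → ℂ) :
    star f ⬝ᵥ (T *ᵥ f)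
      = ∑ p : Tor N, star (fun i => (dftC N m *ᵥ f) (p, i)) ⬝ᵥ
          (symb N m T p *ᵥ fun i => (dftC N m *ᵥ f) (p, i)) := by
  conv_lhs => rw [eq_star_dftC_mul_fibreOp_mul_dftC N m hT]
  rw [← Matrix.mulVec_mulVec, ← Matrix.mulVec_mulVec, Matrix.dotProduct_mulVec]
  have h : star f ᵥ* star (dftC N m) = star (dftC N m *ᵥ f) := by
    rw [Matrix.star_mulVec, Matrix.star_eq_conjTranspose]
  rw [h]
  exact star_dotProduct_fibreOp_mulVec N m (symb N m T) (dftC N m *ᵥ f)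

/-- **Plancherel** for `F⊗1`: `⟨f̂, f̂⟩ = ⟨f, f⟩`, i.e. `Σ_p ‖f̂(p)‖² = ‖f‖²` (the case σ_k = 1 of (7.1.2)).
[cite: BalabanImbrieJaffe1985, (7.1.2) p.321] -/
theorem plancherel_dftC (f : Tor N × m → ℂ) :
    star (dftC N m *ᵥ f) ⬝ᵥ (dftC N m *ᵥ f) = star f ⬝ᵥ f := by
  rw [Matrix.star_mulVec, ← Matrix.dotProduct_mulVec, Matrix.mulVec_mulVec,
    ← Matrix.star_eq_conjTranspose, star_dftC_mul, Matrix.one_mulVec]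

/-- kernel: `⟨v, v⟩ = Σ ‖v_a‖²`. [folklore] -/
private theorem star_dotProduct_self {ι : Type*} [Fintype ι] (v : ι → ℂ) :
    star v ⬝ᵥ v = ((∑ a, ‖v a‖ ^ 2 : ℝ) : ℂ) := by
  simp only [dotProduct, Pi.star_apply, Complex.star_def, Complex.conj_mul']
  push_cast
  rfl

/-- Plancherel for the norms: `‖f‖² = Σ_p Σ_i |f̂_i(p)|²`. [cite: BalabanImbrieJaffe1985, (7.1.2) p.321] -/
theorem sum_norm_sq_eq_sum_norm_sq_dftC (f : Tor N × m → ℂ) :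
    ∑ a, ‖f a‖ ^ 2 = ∑ p : Tor N, ∑ i : m, ‖(dftC N m *ᵥ f) (p, i)‖ ^ 2 := by
  have h := plancherel_dftC N m f
  rw [star_dotProduct_self, star_dotProduct_self] at h
  rw [← Complex.ofReal_injective h, Fintype.sum_prod_type]

/-! ## §5 (7.1.22) ⇒ (7.1.1): fibrewise lower bounds are configuration-space lower bounds, and conversely -/

/-- **"It is sufficient to show that there is a constant c > 0 such that c ≤ σ_k(p) (7.1.22) for all |p_j| ≤ π"** (proof of
Proposition 7.1.2, p. 324 [PDF 26]) — the Plancherel passage, PROVED for every translation-invariant `T` on the finite unit torus: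
a fibrewise bound `c‖v‖² ≤ Re⟨v, σ(p)v⟩` at every dual momentum `p` gives `c‖f‖² ≤ Re⟨f, Tf⟩` for every field `f`.
[cite: BalabanImbrieJaffe1985, Prop. 7.1.2 (7.1.22) p.324] -/
theorem form_re_ge_of_fibrewise {T : Matrix (Tor N × m) (Tor N × m) ℂ} (hT : IsTranslInv N m T) {c : ℝ}
    (hc : ∀ (p : Tor N) (v : m → ℂ), c * ∑ i, ‖v i‖ ^ 2 ≤ (star v ⬝ᵥ (symb N m T p *ᵥ v)).re)
    (f : Tor N × m → ℂ) :
    c * ∑ a, ‖f a‖ ^ 2 ≤ (star f ⬝ᵥ (T *ᵥ f)).re := by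
  rw [eq712 N m hT f, Complex.re_sum, sum_norm_sq_eq_sum_norm_sq_dftC N m f, Finset.mul_sum]
  exact Finset.sum_le_sum fun p _ => hc p _

/-- kernel: the field with a single momentum mode `p` and fibre vector `v`, in momentum space. [folklore] -/
private def modeAt (p : Tor N) (v : m → ℂ) : Tor N × m → ℂ := fun a => if a.1 = p then v a.2 else 0

/-- kernel: `(F⊗1)((F⊗1)^* e) = e`. [folklore] -/
private theorem dftC_mulVec_star_mulVec (e : Tor N × m → ℂ) :
    dftC N m *ᵥ (star (dftC N m) *ᵥ e) = e := by
  rw [Matrix.mulVec_mulVec, dftC_mul_star, Matrix.one_mulVec]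

/-- **Converse of the passage** (sharpness of (7.1.22) on a finite torus): a configuration-space bound `c‖f‖² ≤ Re⟨f, Tf⟩`
for all `f` forces `c‖v‖² ≤ Re⟨v, σ(p)v⟩` at EVERY dual momentum `p` (test `f = (F⊗1)^*(δ_p ⊗ v)`); in particular the
momenta with a vanishing component are not negligible on T₁^{(k)}. [cite: BalabanImbrieJaffe1985, Prop. 7.1.2 (7.1.22) p.324] -/
theorem fibrewise_of_form_re_ge {T : Matrix (Tor N × m) (Tor N × m) ℂ} (hT : IsTranslInv N m T) {c : ℝ}
    (h : ∀ f : Tor N × m → ℂ, c * ∑ a, ‖f a‖ ^ 2 ≤ (star f ⬝ᵥ (T *ᵥ f)).re) (p : Tor N) (v : m → ℂ) :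
    c * ∑ i, ‖v i‖ ^ 2 ≤ (star v ⬝ᵥ (symb N m T p *ᵥ v)).re := by
  have hp : ∀ i, modeAt N m p v (p, i) = v i := fun i => if_pos rfl
  have hq : ∀ q : Tor N, q ≠ p → ∀ i, modeAt N m p v (q, i) = 0 := fun q hq i => if_neg hq
  -- in momentum space the test field is `δ_p ⊗ v`: only the fibre `p` carries norm and form
  have hnorm : ∑ q : Tor N, ∑ i : m, ‖modeAt N m p v (q, i)‖ ^ 2 = ∑ i, ‖v i‖ ^ 2 := by
    rw [Finset.sum_eq_single p]
    · simp only [hp]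
    · intro q _ hqp
      simp only [hq q hqp, norm_zero, zero_pow two_ne_zero, Finset.sum_const_zero]
    · exact fun h => absurd (Finset.mem_univ p) h
  have hform : ∑ q : Tor N, star (fun i => modeAt N m p v (q, i)) ⬝ᵥ
      (symb N m T q *ᵥ fun i => modeAt N m p v (q, i)) = star v ⬝ᵥ (symb N m T p *ᵥ v) := by
    rw [Finset.sum_eq_single p]
    · simp only [hp]
    · intro q _ hqp
      have h0 : (fun i => modeAt N m p v (q, i)) = 0 := funext fun i => hq q hqp i
      rw [h0, Matrix.mulVec_zero, dotProduct_zero]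
    · exact fun h => absurd (Finset.mem_univ p) h
  have key := h (star (dftC N m) *ᵥ modeAt N m p v)
  rw [eq712 N m hT, sum_norm_sq_eq_sum_norm_sq_dftC N m, dftC_mulVec_star_mulVec, hnorm, hform] at key
  exact key

/-! ## §6 Symmetric operators: Hermitian symbols -/

/-- "σ_k … symmetric": for a Hermitian translation-invariant `T` every symbol `σ(p)` is Hermitian.
[cite: BalabanImbrieJaffe1985, (7.1.2) p.321] -/
theorem symb_isHermitian {T : Matrix (Tor N × m) (Tor N × m) ℂ} (hT : IsTranslInv N m T) (hH : T.IsHermitian)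
    (p : Tor N) : (symb N m T p).IsHermitian := by
  have hc : (dftC N m * T * star (dftC N m)).IsHermitian := by
    rw [Matrix.star_eq_conjTranspose]
    exact Matrix.isHermitian_mul_mul_conjTranspose _ hH
  rw [dftC_conj_eq_fibreOp N m hT] at hc
  refine Matrix.IsHermitian.ext fun i j => ?_
  have h := hc.apply (p, i) (p, j)
  rwa [fibreOp_apply, fibreOp_apply, if_pos rfl, if_pos rfl] at h

end Torus

/-! ## §7 Theorem 7.1.1 for a configuration-space family k ↦ σ_k, from fibrewise bounds -/

section Family

variable {d : ℕ} (N : ℕ → Fin d → ℕ) [hN : ∀ k μ, NeZero (N k μ)] (m : Type) [Fintype m] [DecidableEq m]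
  (T : (k : ℕ) → Matrix (Tor (N k) × m) (Tor (N k) × m) ℂ)

/-- The configuration-space datum of Theorem 7.1.1 for a family k ↦ T_k of operators on multi-component fields over the
unit tori T₁^{(k)} (torus sizes `N k`): r15's `SigmaForm` with `Plaq` = fields `Tor (N k) × m → ℂ`, `‖f‖² = Σ_a |f(a)|²`,
`⟨f, σ_k f⟩ := Re (star f ⬝ᵥ T_k f)`. [cite: BalabanImbrieJaffe1985, Thm. 7.1.1 p.321] -/
def sigmaFormOf (k : ℕ) : SigmaForm where
  Plaq := Tor (N k) × m → ℂ
  normSq f := ∑ a, ‖f a‖ ^ 2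
  sigma f := (star f ⬝ᵥ (T k *ᵥ f)).re

/-- **Theorem 7.1.1 from (7.1.22)**, for the configuration-space operators: if every `T_k` is translation invariant and ONE
constant `c > 0` bounds every fibre from below, `c‖v‖² ≤ Re⟨v, σ_k(p)v⟩` for all k, all dual momenta p of T₁^{(k)} and all v,
then `Thm711` holds for the family `sigmaFormOf N m T` with that `c` (*"It is sufficient to show … c ≤ σ_k(p) (7.1.22)"*).
[cite: BalabanImbrieJaffe1985, Prop. 7.1.2 (7.1.22) p.324] -/
theorem thm711_of_fibrewise (hT : ∀ k, IsTranslInv (N k) m (T k)) {c : ℝ} (hc : 0 < c)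
    (hfib : ∀ (k : ℕ) (p : Tor (N k)) (v : m → ℂ),
      c * ∑ i, ‖v i‖ ^ 2 ≤ (star v ⬝ᵥ (symb (N k) m (T k) p *ᵥ v)).re) :
    Thm711 (sigmaFormOf N m T) :=
  ⟨c, hc, fun k f => form_re_ge_of_fibrewise (N k) m (hT k) (hfib k) f⟩

/-- **Theorem 7.1.1 from (7.1.22) at real momenta**: the same when the fibres are given by a symbol FUNCTION `S k` of the
reduced real momentum `p_ν = 2π n_ν/N_ν ∈ [−π, π]` of the dual-torus point (`B5Prop11Plancherel.sOf`, |p_ν| ≤ π by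
`abs_sOf_le`) and the bound `c ≤ S k p` is known *"for all |p_j| ≤ π"* — the printed quantifier of (7.1.22), momenta with
vanishing components INCLUDED.  (For the σ_k of (4.2.2) the hypothesis `hS` is the identification (7.1.13), not proved here.)
[cite: BalabanImbrieJaffe1985, Prop. 7.1.2 (7.1.22) p.324] -/
theorem thm711_of_realMomenta (hT : ∀ k, IsTranslInv (N k) m (T k)) (S : ℕ → (Fin d → ℝ) → Matrix m m ℂ)
    (hS : ∀ (k : ℕ) (q : Tor (N k)), symb (N k) m (T k) q = S k (sOf (N k) q)) {c : ℝ} (hc : 0 < c)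
    (hfib : ∀ (k : ℕ) (p : Fin d → ℝ), (∀ ν, |p ν| ≤ Real.pi) →
      ∀ v : m → ℂ, c * ∑ i, ‖v i‖ ^ 2 ≤ (star v ⬝ᵥ (S k p *ᵥ v)).re) :
    Thm711 (sigmaFormOf N m T) :=
  thm711_of_fibrewise N m T hT hc fun k q v => by
    rw [hS]
    exact hfib k _ (fun ν => abs_sOf_le (N k) q ν) v

/-- Conversely, the constant of Theorem 7.1.1 for the configuration-space family is a fibrewise constant at every dual
momentum of every T₁^{(k)} (sharpness of the reduction (7.1.22)). [cite: BalabanImbrieJaffe1985, Prop. 7.1.2 (7.1.22) p.324] -/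
theorem fibrewise_of_thm711 (hT : ∀ k, IsTranslInv (N k) m (T k)) (h : Thm711 (sigmaFormOf N m T)) :
    ∃ c : ℝ, 0 < c ∧ ∀ (k : ℕ) (p : Tor (N k)) (v : m → ℂ),
      c * ∑ i, ‖v i‖ ^ 2 ≤ (star v ⬝ᵥ (symb (N k) m (T k) p *ᵥ v)).re := by
  obtain ⟨c, hc, hall⟩ := h
  exact ⟨c, hc, fun k p v => fibrewise_of_form_re_ge (N k) m (hT k) (hall k) p v⟩

end Family

end

end Literature.MathematicalPhysics.QuantumFieldTheory.BalabanImbrieJaffe1984to88.BIJ85Eq712Plancherel
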